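import Mathlib
import HarnessLib

/-!
# Non-square descent — UNIVERSAL NORMS: (i) a chain of norm subgroups of bounded finite index stabilises, (ii) an element that is a norm from
# EVERY finite level is a universal norm (comes from a norm-coherent sequence) when the levels are adically complete with finite truncations
# — the limit bookkeeping turning the level-wise bound `[𝓔_n^χ : N_{m,n}𝓔_m^χ] ≤ C` into `[𝓔_n^χ : 𝒩_n] ≤ C` (stub S2 residue of line
# `nonsquare-descent`) — seed crux `SignedMuSeedAtTwoPlus` stmt-BirchSwinnertonDyer-21438 (parent Kμ⁺ `SignedMuVanishingAtTwoPlus`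
# stmt-BirchSwinnertonDyer-20689, route ResidualThetaTransportAtTwo), line card `Cruxes/SignedMuSeedAtTwoPlus/Lines/nonsquare-descent.md`

Cell `bsd-wall`, width seat `bsd-wall-rtt-p4-w2` g19 (`--supports`, closes nothing).  THEOREMS ONLY; BSD is not proved by this and nothing
arithmetic is asserted: module algebra over a commutative ring.

g18's `…NormIndexSplit` leaves the factor `#(E_n ⧸ range π)` — units modulo UNIVERSAL norms `𝒩_n = π_n(Ē)`, the image of the norm-coherent
limit — while the Herbrand/capitulation chain (`…HerbrandIndex`, `…HilbertNinety`, `…CapitulationSplit`, this seat) bounds the FINITE-LEVEL indices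
`[E_n : N_{m,n}E_m]`.  The passage between the two is this file:

* §1 **stabilisation** (`Nat.card`, any module): `natCard_quotient_dvd_of_le` (`N' ≤ N ⟹ #(M/N) ∣ #(M/N')`), `le_of_natCard_quotient_eq`
  (equal finite index forces equality), **`exists_forall_eq_of_antitone`** (an antitone chain `N m` with `#(M/N m) ≤ K`, all finite, is
  eventually constant), `exists_iInf_eq_of_antitone`, **`natCard_quotient_iInf_le`** (`#(M / ⋂ N m) ≤ K`, finite).
* §2 **universal norms** along a tower `N i : E (i+1) → E i` of `R`-modules that are `I`-ADICALLY COMPLETE with FINITE truncations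
  `E i / I^k E i` (e.g. finitely generated `ℤ₂`-modules such as `𝓔_m^χ ⊗ ℤ₂`): `smodEq_map_pow_smul_top`;
  **`exists_coherent_of_forall_exists_chain`** — if `x₀ ∈ E 0` is the end of a norm-chain of EVERY finite length (`x₀ ∈ ⋂_j N_{j→0}(E j)`),
  then `x₀` is the `0`-th term of an INFINITE norm-coherent sequence (`x₀ ∈ 𝒩_0`); proof: König (Mathlib
  `nonempty_sections_of_finite_inverse_system`) on the finite non-empty sets of truncated chains modulo `I^j`, then adic completeness to pass
  from chains coherent modulo `I^j` to honest limits, Hausdorff-ness for exact coherence; `setOf_exists_coherent_eq_iInter` (`𝒩_0 = ⋂_j N_{j→0}(E j)`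
  as sets).

So `[E_n : 𝒩_n] = [E_n : ⋂_m N_{m,n}E_m] ≤ sup_m [E_n : N_{m,n}E_m]`, and the right side is what the Herbrand/capitulation chain bounds.  [folklore]
-/

set_option autoImplicit false
-- the Theorems namespace of this sub repeats the summit name by design (D-0017 nested layout)
set_option linter.dupNamespace false

namespace Summit.BirchSwinnertonDyer.BirchSwinnertonDyer.Theorems.SignedMuAtTwo.NonsquareDescent

universe u v

/-! ## §1 A chain of subgroups of bounded finite index stabilises -/

section Stabilisation

variable {R : Type u} [CommRing R] {M : Type v} [AddCommGroup M] [Module R M]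

/-- `N' ≤ N ⟹ #(M/N) ∣ #(M/N')` (`Nat.card`, unconditional). [folklore] -/
theorem natCard_quotient_dvd_of_le {N N' : Submodule R M} (h : N' ≤ N) :
    Nat.card (M ⧸ N) ∣ Nat.card (M ⧸ N') :=
  Dvd.intro_left _ (Submodule.card_quotient_mul_card_quotient N N' h)

/-- Two nested submodules with the same FINITE index are equal. [folklore] -/
theorem le_of_natCard_quotient_eq {N N' : Submodule R M} (h : N' ≤ N) (hfin : Nat.card (M ⧸ N') ≠ 0)
    (heq : Nat.card (M ⧸ N) = Nat.card (M ⧸ N')) : N ≤ N' := by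
  have key := Submodule.card_quotient_mul_card_quotient N N' h
  rw [heq] at key
  have h1 : Nat.card (N.map N'.mkQ) = 1 :=
    Nat.eq_of_mul_eq_mul_right (Nat.pos_of_ne_zero hfin) (key.trans (one_mul _).symm)
  have hsub : Subsingleton (N.map N'.mkQ) := (Nat.card_eq_one_iff_unique.1 h1).1
  have hbot : N.map N'.mkQ = ⊥ := by
    rw [Submodule.eq_bot_iff]
    intro x hx
    exact congrArg Subtype.val (Subsingleton.elim (⟨x, hx⟩ : N.map N'.mkQ) ⟨0, Submodule.zero_mem _⟩)
  have := LinearMap.le_ker_iff_map.2 hbot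
  rwa [Submodule.ker_mkQ] at this

/-- **Stabilisation.**  An antitone chain of submodules `N m` with `#(M/N m) ≤ K` finite for all `m` is eventually constant.
(«the norm subgroups `N_{m,n}𝓔_m^χ ⊗ ℤ₂`, `m ≥ n`, of index `≤ #F^χ` stabilise».) [folklore] -/
theorem exists_forall_eq_of_antitone (N : ℕ → Submodule R M) (hN : Antitone N) (K : ℕ)
    (hK : ∀ m, Nat.card (M ⧸ N m) ≤ K) (hfin : ∀ m, Nat.card (M ⧸ N m) ≠ 0) :
    ∃ m₀, ∀ m, m₀ ≤ m → N m = N m₀ := by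
  have hne : (Set.range fun m => Nat.card (M ⧸ N m)).Nonempty := Set.range_nonempty _
  have hbdd : BddAbove (Set.range fun m => Nat.card (M ⧸ N m)) := ⟨K, by rintro _ ⟨m, rfl⟩; exact hK m⟩
  obtain ⟨m₀, hm₀⟩ := Nat.sSup_mem hne hbdd
  refine ⟨m₀, fun m hm => ?_⟩
  have hle : N m ≤ N m₀ := hN hm
  have h2 : Nat.card (M ⧸ N m) ≤ Nat.card (M ⧸ N m₀) := by
    have := le_csSup hbdd ⟨m, rfl⟩
    rwa [← hm₀] at this
  have h3 : Nat.card (M ⧸ N m₀) ≤ Nat.card (M ⧸ N m) :=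
    Nat.le_of_dvd (Nat.pos_of_ne_zero (hfin m)) (natCard_quotient_dvd_of_le hle)
  exact le_antisymm hle (le_of_natCard_quotient_eq hle (hfin m) (le_antisymm h3 h2))

/-- The intersection of such a chain is one of its terms. [folklore] -/
theorem exists_iInf_eq_of_antitone (N : ℕ → Submodule R M) (hN : Antitone N) (K : ℕ)
    (hK : ∀ m, Nat.card (M ⧸ N m) ≤ K) (hfin : ∀ m, Nat.card (M ⧸ N m) ≠ 0) :
    ∃ m₀, (⨅ m, N m) = N m₀ := by
  obtain ⟨m₀, h⟩ := exists_forall_eq_of_antitone N hN K hK hfin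
  refine ⟨m₀, le_antisymm (iInf_le _ m₀) (le_iInf fun m => ?_)⟩
  by_cases hm : m₀ ≤ m
  · rw [h m hm]
  · exact hN (le_of_not_ge hm)

/-- **`#(M / ⋂ₘ N m) ≤ K` and finite**: the index of the intersection of an antitone chain of submodules of finite index `≤ K` is finite and
`≤ K`. («`[𝓔_n^χ ⊗ ℤ₂ : ⋂_m N_{m,n}𝓔_m^χ ⊗ ℤ₂] ≤ #F^χ`».) [folklore] -/
theorem natCard_quotient_iInf_le (N : ℕ → Submodule R M) (hN : Antitone N) (K : ℕ)
    (hK : ∀ m, Nat.card (M ⧸ N m) ≤ K) (hfin : ∀ m, Nat.card (M ⧸ N m) ≠ 0) :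
    Nat.card (M ⧸ ⨅ m, N m) ≤ K ∧ Nat.card (M ⧸ ⨅ m, N m) ≠ 0 := by
  obtain ⟨m₀, h⟩ := exists_iInf_eq_of_antitone N hN K hK hfin
  rw [h]
  exact ⟨hK m₀, hfin m₀⟩

end Stabilisation

/-! ## §2 An element that is a norm from every finite level is a universal norm (adically complete levels, finite truncations) -/

section Koenig

open CategoryTheory

variable {R : Type u} [CommRing R] (I : Ideal R)

/-- A linear map preserves congruences modulo `I^k • ⊤`. [folklore] -/
theorem smodEq_map_pow_smul_top {A : Type v} {B : Type*} [AddCommGroup A] [Module R A] [AddCommGroup B] [Module R B]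
    (f : A →ₗ[R] B) (k : ℕ) {x y : A} (h : x ≡ y [SMOD (I ^ k • ⊤ : Submodule R A)]) :
    f x ≡ f y [SMOD (I ^ k • ⊤ : Submodule R B)] := by
  refine SModEq.mono ?_ (h.map f)
  rw [Submodule.map_smul'', Submodule.map_top]
  exact Submodule.smul_mono le_rfl le_top

variable (E : ℕ → Type v) [∀ i, AddCommGroup (E i)] [∀ i, Module R (E i)] (N : ∀ i, E (i + 1) →ₗ[R] E i)

/-- **UNIVERSAL NORMS.**  Along a tower `N i : E (i+1) → E i` of `I`-adically complete `R`-modules with finite truncations `E i / I^k E i`,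
an element `x₀ ∈ E 0` that is the end of a norm-chain of EVERY finite length `j` (`∃ y, y 0 = x₀ ∧ N i (y (i+1)) = y i` for `i < j` —
«`x₀ ∈ N_{j→0}(E j)` for all `j`») is the `0`-th term of an infinite norm-coherent sequence («`x₀ ∈ 𝒩_0 = π_0(lim E i)`»).
Proof: the truncated chains modulo `I^j` form an inverse system of finite non-empty sets, which has a section (König, Mathlib
`nonempty_sections_of_finite_inverse_system`); chains realising the section are coherent modulo `I^j` at every fixed level, hence converge
adically, and the limits form an honest coherent sequence by Hausdorff-ness. [folklore] -/
theorem exists_coherent_of_forall_exists_chain [∀ i, IsAdicComplete I (E i)]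
    (hfin : ∀ i k, Finite (E i ⧸ (I ^ k • ⊤ : Submodule R (E i)))) (x₀ : E 0)
    (hchain : ∀ j : ℕ, ∃ y : ∀ i, E i, y 0 = x₀ ∧ ∀ i, i < j → N i (y (i + 1)) = y i) :
    ∃ x : ∀ i, E i, x 0 = x₀ ∧ ∀ i, N i (x (i + 1)) = x i := by
  classical
  -- truncated chains of length `j`, read modulo `I^j` at the levels `i ≤ j`
  let X : ℕ → Type v := fun j =>
    {t : ∀ i : Fin (j + 1), E i ⧸ (I ^ j • ⊤ : Submodule R (E i)) //
      ∃ y : ∀ i, E i, y 0 = x₀ ∧ (∀ i, i < j → N i (y (i + 1)) = y i) ∧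
        ∀ (i : ℕ) (hi : i ≤ j), Submodule.Quotient.mk (y i) = t ⟨i, Nat.lt_succ_of_le hi⟩}
  let f : ∀ j, (X (j + 1) ⟶ X j) := fun j => TypeCat.ofHom fun t =>
    ⟨fun i => Submodule.factorPowSucc I (E i) j (t.1 ⟨i, by omega⟩), by
      obtain ⟨y, hy0, hyN, hyt⟩ := t.2
      refine ⟨y, hy0, fun i hi => hyN i (Nat.lt_succ_of_lt hi), fun i hi => ?_⟩
      show Submodule.Quotient.mk (y i) = Submodule.factorPowSucc I (E i) j (t.1 ⟨i, by omega⟩)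
      rw [← hyt i (hi.trans (Nat.le_succ j))]
      rfl⟩
  haveI hne : ∀ j, Nonempty (X j) := fun j => by
    obtain ⟨y, hy0, hyN⟩ := hchain j
    exact ⟨⟨fun i => Submodule.Quotient.mk (y i), y, hy0, hyN, fun i hi => rfl⟩⟩
  haveI hfi : ∀ j, Finite (X j) := fun j => by
    haveI : ∀ i : Fin (j + 1), Finite (E i ⧸ (I ^ j • ⊤ : Submodule R (E i))) := fun i => hfin i j
    infer_instance
  haveI : ∀ j : ℕᵒᵖ, Nonempty ((Functor.ofOpSequence f).obj j) := fun j => hne j.unop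
  haveI : ∀ j : ℕᵒᵖ, Finite ((Functor.ofOpSequence f).obj j) := fun j => hfi j.unop
  obtain ⟨s, hs⟩ := nonempty_sections_of_finite_inverse_system (Functor.ofOpSequence f)
  -- compatibility of the section: `f j (s (j+1)) = s j`
  have hs' : ∀ j, (f j) (s (Opposite.op (j + 1))) = s (Opposite.op j) := fun j => by
    have h1 := hs (homOfLE (Nat.le_add_right j 1)).op
    rwa [Functor.ofOpSequence_map_homOfLE_succ] at h1
  -- chains realising the section
  let y : ∀ j, ∀ i, E i := fun j => Classical.choose (s (Opposite.op j)).2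
  have hy : ∀ j, y j 0 = x₀ ∧ (∀ i, i < j → N i (y j (i + 1)) = y j i) ∧
      ∀ (i : ℕ) (hi : i ≤ j), Submodule.Quotient.mk (y j i) = (s (Opposite.op j)).1 ⟨i, Nat.lt_succ_of_le hi⟩ :=
    fun j => Classical.choose_spec (s (Opposite.op j)).2
  -- consecutive chains agree modulo `I^j` at the levels `i ≤ j`
  have hstep : ∀ (j i : ℕ), i ≤ j → y j i ≡ y (j + 1) i [SMOD (I ^ j • ⊤ : Submodule R (E i))] := by
    intro j i hi
    have a := (hy j).2.2 i hi
    have b := (hy (j + 1)).2.2 i (hi.trans (Nat.le_succ j))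
    have c := congrFun (congrArg Subtype.val (hs' j)) ⟨i, Nat.lt_succ_of_le hi⟩
    -- `c : factorPowSucc (s (j+1) ⟨i⟩) = s j ⟨i⟩`
    rw [SModEq.def, a, ← c]
    change Submodule.factorPowSucc I (E i) j ((s (Opposite.op (j + 1))).1 ⟨i, (show i < j + 1 + 1 by omega)⟩) = _
    rw [← b]
    rfl
  -- hence all later chains agree with chain `j` modulo `I^j`
  have hcoh : ∀ (i j j' : ℕ), i ≤ j → j ≤ j' → y j i ≡ y j' i [SMOD (I ^ j • ⊤ : Submodule R (E i))] := by
    intro i j j' hij hjj'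
    induction j', hjj' using Nat.le_induction with
    | base => exact SModEq.rfl
    | succ j' hjj' ih =>
      exact ih.trans (SModEq.mono (Submodule.pow_smul_top_le I (E i) hjj') (hstep j' i (hij.trans hjj')))
  -- the level-`i` Cauchy sequence `k ↦ y (i+k) i` converges
  have hlim : ∀ i, ∃ L : E i, ∀ k, y (i + k) i ≡ L [SMOD (I ^ k • ⊤ : Submodule R (E i))] := by
    intro i
    refine IsPrecomplete.prec (IsAdicComplete.toIsPrecomplete) fun {m n} hmn => ?_
    exact SModEq.mono (Submodule.pow_smul_top_le I (E i) (Nat.le_add_left m i))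
      (hcoh i (i + m) (i + n) (Nat.le_add_right i m) (Nat.add_le_add_left hmn i))
  choose x hx using hlim
  refine ⟨x, ?_, fun i => ?_⟩
  · -- `x 0 = x₀`
    symm
    refine sub_eq_zero.1 (IsHausdorff.haus (IsAdicComplete.toIsHausdorff : IsHausdorff I (E 0)) _ fun k => ?_)
    rw [SModEq.zero, ← SModEq.sub_mem]
    have h := hx 0 k
    rw [(hy (0 + k)).1] at h
    exact h
  · -- coherence `N i (x (i+1)) = x i`
    refine sub_eq_zero.1 (IsHausdorff.haus (IsAdicComplete.toIsHausdorff : IsHausdorff I (E i)) _ fun k => ?_)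
    rw [SModEq.zero, ← SModEq.sub_mem]
    have h1 : N i (y (i + 1 + k) (i + 1)) ≡ N i (x (i + 1)) [SMOD (I ^ k • ⊤ : Submodule R (E i))] :=
      smodEq_map_pow_smul_top I (N i) k (hx (i + 1) k)
    have h2 : N i (y (i + 1 + k) (i + 1)) = y (i + 1 + k) i := (hy (i + 1 + k)).2.1 i (by omega)
    have h3 : y (i + (k + 1)) i ≡ x i [SMOD (I ^ k • ⊤ : Submodule R (E i))] :=
      SModEq.mono (Submodule.pow_smul_top_le I (E i) (Nat.le_succ k)) (hx i (k + 1))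
    have e : i + 1 + k = i + (k + 1) := by omega
    rw [h2, e] at h1
    exact h1.symm.trans h3

/-- **`𝒩_0 = ⋂_j N_{j→0}(E j)`** as sets: the ends of infinite norm-coherent sequences are exactly the elements that end a norm-chain of every
finite length (adically complete levels with finite truncations). [folklore] -/
theorem setOf_exists_coherent_eq_iInter [∀ i, IsAdicComplete I (E i)]
    (hfin : ∀ i k, Finite (E i ⧸ (I ^ k • ⊤ : Submodule R (E i)))) :
    {x₀ : E 0 | ∃ x : ∀ i, E i, x 0 = x₀ ∧ ∀ i, N i (x (i + 1)) = x i} =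
      ⋂ j : ℕ, {x₀ : E 0 | ∃ y : ∀ i, E i, y 0 = x₀ ∧ ∀ i, i < j → N i (y (i + 1)) = y i} := by
  ext x₀
  simp only [Set.mem_setOf_eq, Set.mem_iInter]
  constructor
  · rintro ⟨x, hx0, hx⟩ j
    exact ⟨x, hx0, fun i _ => hx i⟩
  · intro h
    exact exists_coherent_of_forall_exists_chain I E N hfin x₀ h

end Koenig

end Summit.BirchSwinnertonDyer.BirchSwinnertonDyer.Theorems.SignedMuAtTwo.NonsquareDescent
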